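import Summits.QuantumFields.BalabanUV.Beta.GAN24.Entry110LapFlat
import Summits.QuantumFields.BalabanUV.Beta.GAN24.Entry110GradCubic

/-!
# G-an2-4 ∕ (CONV-C), INTERFACE REQUEST (B5-1115-TABLE), item (E4), step 2: [B5] (1.110) FOURTH ENTRY «|(ΔGJ)(x)| ≤ O(1)e^{−δ₀|y−y′|}|J|»
# for `G = Δ_1⁻¹ = (DeltaA n M 1)⁻¹`, `Δ = B5Prop11Lower.Lap n M`, AT `U = 1`, `a = 1`, ON EVERY CUBIC UNIT TORUS, UNIFORMLY IN THE
# SPACING — transported from the NE3 carrier (step 1, `GAN24/Entry110LapFlat`) to Bałaban's fine torus, and the general reduction behind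
# the named statement `Entry110Lap`

G-an2-4 formalisation swarm `b2b-balaban-gan24-formalise-*`, leaf prover 04 (gen 46), crux team (2) under the coordinator ruling
«YM REDIRECT» (e34b3e0c); toward the road-P2 crux prover's **INTERFACE REQUEST G-an2-4: (B5-1115-TABLE)** (unit `b2b-balaban-gan24-p2`
gen 28, `HOME/INBOX.md` 2026-08-21T05:44Z) item **(E4)**, typed by leaf 01 (gen 53) as `B5Prop12Entries110.Entry110Lap d a` (p250927;
quantified over EVERY torus `M`).  On the NE3 carrier the kernel of `Δ·Δ_1⁻¹` IS `stencilE·gFlat j` (§1: `η²·LapR = stencilE` by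
`SliceFlatStencil.scaled_LapR_eq_stencil`, `gFlat = η⁻²·GR` by `SliceFlatOperators.gFlat_eq`, the two factors cancel; realness of both
matrices, pv15's `B5RealFields`); step 1 bounded its cube sums (`Entry110LapFlat.cubeSum_stencilE_mul_gFlat_le`, O(1)); THIS FILE is the
dictionary + transport (the pattern of `GradientRowSumTransport` §3) and the (1.110) sup entry:
 * §1 `stencilE_mul_gFlat_eq_RI`, **`abs_stencilE_mul_gFlat_eq`**: `|(stencilE·gFlat j)(p,q)| = ‖(Lap·Δ_1⁻¹)(eF p, eF q)‖`;
 * §2 **`block_row_sum_Lap_mul_inv_le`**: from ANY constants `(B₄, δ ≥ 0)` satisfying step 1's statement, for `j ≤ k`, every row `i` and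
   every block `y′` of `Tor (fine (side k L j) (Mlev d k N L j))`: `Σ_{x′ : blockOf x′ = y′} ‖(Lap·Δ_1⁻¹)(i,x′)‖ ≤ B₄·e^{−δ·|blockOf(i) − y′|_{T₁,∞}}`;
 * §3 **`entry110Lap_of_block_row_sum`** (ANY `a`): such a per-block bound on EVERY torus IMPLIES the named `Entry110Lap d a`
   (`Δ (G J) = (Δ·G) J` and `Entry110GradCubic.norm_mulVec_bpt_le_of_block_row_sum`) — what remains for the named Prop is the
   rectangular case;
 * §4 `block_row_sum_Lap_mul_inv_le_cubic` — packaged for every spacing `n ≥ 1` and every CUBIC unit torus (witness `(k,N,L,j) = (1,N₀,n,1)`);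
 * §5 END **`entry110Lap_one_cubic`**: the BODY of `Entry110Lap d 1` VERBATIM at `M := fun _ => N₀`: `∃ δ₀ C > 0` (functions of `d`) with,
   for every `n ≥ 1`, `N₀ ≥ 1`, `y, y′`, `J` supported in `B(y′)` with `|J| ≤ B`, `x = n·y + r ∈ B(y)`, `μ`:
   `‖(Δ (Δ_1⁻¹ J))_μ(x)‖ ≤ C·e^{−δ₀·|y − y′|_{T₁,∞}}·B`.

HONEST SCOPE.  (i) `a = 1`, `U = 1`.  (ii) CUBIC unit tori only — the named Prop `Entry110Lap d 1` (∀ `M`) is NOT discharged; its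
rectangular case needs a rectangular-torus free heat-kernel chain or a covering ∕ periodisation bridge for `DeltaA⁻¹` (located, not claimed;
§3 records what is missing).  (iii) The Hölder and `L²` entries (1.111)–(1.117) are untouched.  (iv) Unit cubes `B` for the printed `Δ̃`.
(v) Constants are NE3's existential `(B₄, δ)(d)`; nothing printed is asserted — [B5] `Balaban1984PropagatorsI` p. 35 (1.110) is a TEXT
LOCATION; the analysis is t4-ne3-p1's, the block resummation pv15's.  No `def`, no `def … : Prop`, no `sorry`.  NOT (CONV-C), NEVER
«G-an2-4 closed», NOT NE2 ∕ NE3, NOT D1, NOT BetaPertH, NOT continuum, NOT Clay; not in print — our bookkeeping.  ABSOLUTE RULE of the cell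
kept.  HONEST DEPENDENCY: continuum YM on T⁴ ⇐ BetaPertH ∧ nine spine estimates (0/9 proved); BetaPertH ⇐ (D1) ∧ (D4) ∧ CAP+tail; G-an2-4
gates asym, D1 and NE2/3/4.
-/

noncomputable section

open scoped BigOperators ComplexConjugate Matrix
open Finset

namespace Summit.QuantumFields.BalabanUV.Beta.GAN24.Entry110LapCubic

open Literature.MathematicalPhysics.QuantumFieldTheory.Balaban1983to89
open Literature.MathematicalPhysics.QuantumFieldTheory.Balaban1983to89.TreeLengthTorus (TPt)
open B5Prop11Plancherel (Tor fine)
open B5Prop11Lower (Lap)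
open B5Block118 (bpt)
open B5Blocks16 (blockOf blockOf_bpt)
open B6LowerBound2153Torus (toT rep)
open B5DeltaA169 (DeltaA)
open B5RealFields (reM reM_apply LapR GR isReal_Lap isReal_DeltaA_inv)
open B4TorusKernel.MultiPeriod (torusSupNorm torusSupNorm_nonneg)
open B5Prop12Entries110 (Entry110Lap)
open Summit.QuantumFields.BalabanUV.T4Continuum
open SliceTorusBlocks SliceTorusTower SliceCovariantTower SliceFlatPropagator SliceFlatOperators SliceFlatStencil
open SliceFlatGradient GradientRowSumTransport Entry110LapFlat Entry110GradCubic

variable {d : ℕ}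

/-! ## §1 The unit stencil applied to the flat propagator IS `Δ·Δ_1⁻¹` read through `eF` -/

section Flat

variable (d k N L : ℕ) [NeZero N] [NeZero L]

/-- `stencilE·gFlat j = RI j (Re (Lap·Δ_1⁻¹))`: the factors `η_j²` of `stencilE = η_j²·RI LapR` and `η_j⁻²` of `gFlat = η_j⁻²·RI GR` cancel,
and `LapR·GR = Re(Lap·Δ_1⁻¹)` (both matrices are real). [folklore] -/
theorem stencilE_mul_gFlat_eq_RI (j : ℕ) :
    stencilE d k N L * gFlat d k N L j
      = RI d k N L j (reM (Lap (side k L j) (Mlev d k N L j) * (DeltaA (side k L j) (Mlev d k N L j) 1)⁻¹)) := by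
  have hn : (0 : ℝ) < (side k L j : ℝ) ^ 2 := by have := one_le_side k L j; positivity
  rw [← scaled_LapR_eq_stencil d k N L j, gFlat_eq, Matrix.smul_mul, Matrix.mul_smul, smul_smul, inv_mul_cancel₀ hn.ne',
    one_smul, ← RI_mul, LapR, GR,
    ← (isReal_Lap (side k L j) (Mlev d k N L j)).reM_mul (isReal_DeltaA_inv (side k L j) (Mlev d k N L j) 1)]

/-- **`|(stencilE·gFlat j)(p,q)| = ‖(Lap·Δ_1⁻¹)((eF p₁,p₂),(eF q₁,q₂))‖`** (the product is a real matrix). [folklore] -/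
theorem abs_stencilE_mul_gFlat_eq (j : ℕ) (p q : TPt (d + 1) (N * L ^ k) × Fin (d + 1)) :
    |(stencilE d k N L * gFlat d k N L j) p q|
      = ‖(Lap (side k L j) (Mlev d k N L j) * (DeltaA (side k L j) (Mlev d k N L j) 1)⁻¹)
          (eF d k N L j p.1, p.2) (eF d k N L j q.1, q.2)‖ := by
  have him := ((isReal_Lap (side k L j) (Mlev d k N L j)).mul (isReal_DeltaA_inv (side k L j) (Mlev d k N L j) 1)).im_eq_zero
    (eF d k N L j p.1, p.2) (eF d k N L j q.1, q.2)
  set z := (Lap (side k L j) (Mlev d k N L j) * (DeltaA (side k L j) (Mlev d k N L j) 1)⁻¹)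
    (eF d k N L j p.1, p.2) (eF d k N L j q.1, q.2) with hz
  have hnorm : ‖z‖ = |z.re| := by
    have e : z = ((z.re : ℝ) : ℂ) := Complex.ext (by simp) (by simp [him])
    conv_lhs => rw [e]
    rw [Complex.norm_real, Real.norm_eq_abs]
  rw [hnorm, stencilE_mul_gFlat_eq_RI, RI_apply, reM_apply]

/-! ## §2 The transported per-block bound: (1.110), fourth entry, at `U = 1`, block row sums uniform in the spacing -/

/-- **(1.110), FOURTH ENTRY `ΔG`, `U = 1`, `a = 1`, PER-BLOCK ROW SUMS, n-UNIFORM** — transported from step 1's statement on the NE3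
carrier (any constants `B₄`, `δ ≥ 0` satisfying it): on `Tor (fine (side k L j) (Mlev d k N L j))` (`j ≤ k`), for every row `i` and every
block `y′`, `Σ_{x′ : blockOf x′ = y′} ‖(Lap·Δ_1⁻¹)(i,x′)‖ ≤ B₄·e^{−δ·|blockOf(i) − y′|_{T₁,∞}}`.  (Location of the printed text: [B5]
`Balaban1984PropagatorsI` p. 35, (1.110), fourth entry; the typed inequality is not a quotation.) [folklore] -/
theorem block_row_sum_Lap_mul_inv_le {B₄ δ : ℝ} (hδ : 0 ≤ δ)
    (hflat : ∀ (k N L : ℕ) [NeZero N] [NeZero L] (j : ℕ), j ≤ k →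
      ∀ (p : TPt (d + 1) (N * L ^ k) × Fin (d + 1)) (y₁ : TPt (d + 1) (levM k N L j)),
        ∑ q ∈ Finset.univ.filter (fun q => cubeI (d + 1) k N L (Fin (d + 1)) j q = y₁),
            |(stencilE d k N L * gFlat d k N L j) p q|
          ≤ B₄ * Real.exp (-(δ * nbd (d + 1) k N L j (cubeI (d + 1) k N L (Fin (d + 1)) j p) y₁)))
    {j : ℕ} (hj : j ≤ k) (i : Tor (fine (side k L j) (Mlev d k N L j)) × Fin (d + 1))
    (y' : TPt (d + 1) (levM k N L j)) :
    ∑ x' : Tor (fine (side k L j) (Mlev d k N L j)) × Fin (d + 1),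
        (if blockOf (side k L j) (Mlev d k N L j) x'.1 = y' then
          ‖(Lap (side k L j) (Mlev d k N L j) * (DeltaA (side k L j) (Mlev d k N L j) 1)⁻¹) i x'‖
         else 0)
      ≤ B₄ * Real.exp (-(δ * torusSupNorm (Mlev d k N L j)
          (rep (Mlev d k N L j) (blockOf (side k L j) (Mlev d k N L j) i.1) - rep (Mlev d k N L j) y'))) := by
  -- the row, pulled back along `eF`
  obtain ⟨p, rfl⟩ : ∃ p : TPt (d + 1) (N * L ^ k) × Fin (d + 1), i = (eF d k N L j p.1, p.2) :=
    ⟨((eF d k N L j).symm i.1, i.2), by simp⟩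
  set G := Lap (side k L j) (Mlev d k N L j) * (DeltaA (side k L j) (Mlev d k N L j) 1)⁻¹ with hG
  have hblk : blockOf (side k L j) (Mlev d k N L j) (eF d k N L j p.1, p.2).1 = cubeI (d + 1) k N L (Fin (d + 1)) j p :=
    blockOf_eF d k N L j p.1
  -- the constant is nonnegative (the flat statement at this very instance)
  have hB : 0 ≤ B₄ := by
    have h := (Finset.sum_nonneg fun q _ => abs_nonneg _).trans (hflat k N L j hj p y')
    have hpos : 0 < Real.exp (-(δ * nbd (d + 1) k N L j (cubeI (d + 1) k N L (Fin (d + 1)) j p) y')) := Real.exp_pos _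
    exact (mul_nonneg_iff_of_pos_right hpos).mp h
  -- (1) reindex the block sum along `eF × id`
  have step1 : ∑ x' : Tor (fine (side k L j) (Mlev d k N L j)) × Fin (d + 1),
        (if blockOf (side k L j) (Mlev d k N L j) x'.1 = y' then ‖G (eF d k N L j p.1, p.2) x'‖ else 0)
      = ∑ q : TPt (d + 1) (N * L ^ k) × Fin (d + 1),
        (if cubeI (d + 1) k N L (Fin (d + 1)) j q = y' then ‖G (eF d k N L j p.1, p.2) (eF d k N L j q.1, q.2)‖ else 0) := by
    refine (Fintype.sum_equiv ((eF d k N L j).prodCongr (Equiv.refl _)) _ _ fun q => ?_).symm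
    obtain ⟨z, μ⟩ := q
    simp only [Equiv.prodCongr_apply, Equiv.coe_refl, Prod.map_apply, id_eq]
    rw [blockOf_eF]
    rfl
  -- (2) the summands are the entries of `stencilE·gFlat j`
  have step2 : ∑ q : TPt (d + 1) (N * L ^ k) × Fin (d + 1),
        (if cubeI (d + 1) k N L (Fin (d + 1)) j q = y' then ‖G (eF d k N L j p.1, p.2) (eF d k N L j q.1, q.2)‖ else 0)
      = ∑ q ∈ Finset.univ.filter (fun q => cubeI (d + 1) k N L (Fin (d + 1)) j q = y'),
          |(stencilE d k N L * gFlat d k N L j) p q| := by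
    rw [Finset.sum_filter]
    refine Finset.sum_congr rfl fun q _ => ?_
    split_ifs
    · rw [abs_stencilE_mul_gFlat_eq, ← hG]
    · rfl
  -- (3) step 1's bound and the distance dictionary
  rw [step1, step2]
  have h3 := hflat k N L j hj p y'
  have hT := torusSupNorm_rep_sub_rep_le_nbd d k N L j (cubeI (d + 1) k N L (Fin (d + 1)) j p) y'
  calc ∑ q ∈ Finset.univ.filter (fun q => cubeI (d + 1) k N L (Fin (d + 1)) j q = y'), |(stencilE d k N L * gFlat d k N L j) p q|
      ≤ B₄ * Real.exp (-(δ * nbd (d + 1) k N L j (cubeI (d + 1) k N L (Fin (d + 1)) j p) y')) := h3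
    _ ≤ B₄ * Real.exp (-(δ * torusSupNorm (Mlev d k N L j)
          (rep (Mlev d k N L j) (blockOf (side k L j) (Mlev d k N L j) (eF d k N L j p.1, p.2).1)
            - rep (Mlev d k N L j) y'))) := by
        rw [hblk]
        exact mul_le_mul_of_nonneg_left (Real.exp_le_exp.mpr (neg_le_neg (mul_le_mul_of_nonneg_left hT hδ))) hB

end Flat

/-! ## §3 What the named statement `Entry110Lap d a` needs: a per-block row bound for `Δ·Δ_a⁻¹` on EVERY torus -/

/-- **`Entry110Lap d a` FROM A PER-BLOCK ROW BOUND ON EVERY TORUS**: if there are `B₄, δ > 0` such that for every spacing `n⁻¹`, EVERY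
torus `M`, every row `i` and every block `y′`, `Σ_{x′ : blockOf x′ = y′} ‖(Δ·Δ_a⁻¹)(i,x′)‖ ≤ B₄·e^{−δ·|rep(blockOf i) − rep y′|_{T₁,∞}}`,
then the named fourth entry of (1.110), `B5Prop12Entries110.Entry110Lap d a`, holds (`Δ (G J) = (Δ·G) J`).  The tree supplies the
hypothesis for CUBIC tori at `a = 1` (§4); the rectangular case is what remains for the named Prop. [folklore] -/
theorem entry110Lap_of_block_row_sum (a : ℝ)
    (h : ∃ B₄ δ : ℝ, 0 < B₄ ∧ 0 < δ ∧ ∀ (n : ℕ) (M : Fin (d + 1) → ℕ) [NeZero n] [∀ μ, NeZero (M μ)],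
      ∀ (i : Tor (fine n M) × Fin (d + 1)) (y' : Tor M),
        ∑ x' : Tor (fine n M) × Fin (d + 1),
            (if blockOf n M x'.1 = y' then ‖(Lap n M * (DeltaA n M a)⁻¹) i x'‖ else 0)
          ≤ B₄ * Real.exp (-(δ * torusSupNorm M (rep M (blockOf n M i.1) - rep M y')))) :
    Entry110Lap d a := by
  obtain ⟨B₄, δ, hB, hδ, hblock⟩ := h
  refine ⟨δ, B₄, hδ, hB, ?_⟩
  intro n M _ _ _hn y y' J B hJB hsupp r μ
  rw [Matrix.mulVec_mulVec]
  exact norm_mulVec_bpt_le_of_block_row_sum n M _ (fun i y₁ => hblock n M i y₁) y y' J hJB hsupp r μ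

/-! ## §4 The per-block bound for every spacing and every CUBIC unit torus -/

/-- **(1.110), FOURTH ENTRY `ΔG`, `U = 1`, `a = 1`, PER-BLOCK ROW SUMS, n-UNIFORM, PACKAGED ON CUBIC TORI**: there are `B, δ > 0` depending
on `d` only (the constants of `Entry110LapFlat.cubeSum_stencilE_mul_gFlat_le`) such that for EVERY `n ≥ 1`, EVERY cubic unit torus
`Π_μ ℤ/N₀` (`N₀ ≥ 1`), every row `i` and every block `y′`, `Σ_{x′ : blockOf x′ = y′} ‖(Δ·Δ_1⁻¹)(i,x′)‖ ≤ B·e^{−δ·|rep(blockOf i) − rep y′|_{T₁,∞}}`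
— §2 at the NE3 parameters `(k,N,L,j) = (1,N₀,n,1)`. [folklore] -/
theorem block_row_sum_Lap_mul_inv_le_cubic :
    ∃ B δ : ℝ, 0 < B ∧ 0 < δ ∧ ∀ (n N₀ : ℕ) [NeZero n] [NeZero N₀]
      (i : Tor (fine n (fun _ : Fin (d + 1) => N₀)) × Fin (d + 1)) (y' : Tor (fun _ : Fin (d + 1) => N₀)),
        ∑ x' : Tor (fine n (fun _ : Fin (d + 1) => N₀)) × Fin (d + 1),
            (if blockOf n (fun _ : Fin (d + 1) => N₀) x'.1 = y' then
              ‖(Lap n (fun _ : Fin (d + 1) => N₀) * (DeltaA n (fun _ : Fin (d + 1) => N₀) 1)⁻¹) i x'‖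
             else 0)
          ≤ B * Real.exp (-(δ * torusSupNorm (fun _ : Fin (d + 1) => N₀)
              (rep (fun _ : Fin (d + 1) => N₀) (blockOf n (fun _ : Fin (d + 1) => N₀) i.1)
                - rep (fun _ : Fin (d + 1) => N₀) y'))) := by
  obtain ⟨B₄, δ, hB, hδ, hflat⟩ := cubeSum_stencilE_mul_gFlat_le d
  refine ⟨B₄, δ, hB, hδ, fun n N₀ _ _ i y' => ?_⟩
  have key : ∀ (n' : ℕ) (M' : Fin (d + 1) → ℕ), n' = side 1 n 1 → M' = Mlev d 1 N₀ n 1 →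
      ∀ [NeZero n'] [∀ μ, NeZero (M' μ)] (i : Tor (fine n' M') × Fin (d + 1)) (y' : Tor M'),
        ∑ x' : Tor (fine n' M') × Fin (d + 1),
            (if blockOf n' M' x'.1 = y' then ‖(Lap n' M' * (DeltaA n' M' 1)⁻¹) i x'‖ else 0)
          ≤ B₄ * Real.exp (-(δ * torusSupNorm M' (rep M' (blockOf n' M' i.1) - rep M' y'))) := by
    intro n' M' hn' hM'
    subst hn' hM'
    intro _ _ i y'
    exact block_row_sum_Lap_mul_inv_le d 1 N₀ n hδ.le hflat le_rfl i y'
  exact key n (fun _ => N₀) (by simp [side]) (by funext μ; simp [Mlev, levM]) i y'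

/-! ## §5 END: (1.110), fourth entry, `a = 1`, every spacing, every CUBIC unit torus -/

/-- **(E4) ∕ [B5] (1.110), FOURTH ENTRY, AT `a = 1` ON EVERY CUBIC UNIT TORUS, UNIFORMLY IN THE SPACING** — the body of
`B5Prop12Entries110.Entry110Lap d 1` VERBATIM at `M := fun _ => N₀`: there are `δ₀ > 0`, `C > 0` (depending on `d` only) such that
for every `n ≥ 1`, every `N₀ ≥ 1`, all `y, y′ ∈ ℤ^{d+1}`, every field `J` supported in the unit cube `B(y′)` with `|J| ≤ B`, every site
`x = n·y + r` of `B(y)` and every component `μ`: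
`‖(Δ (Δ_1⁻¹ J))_μ(x)‖ ≤ C·e^{−δ₀·|y − y′|_{T₁,∞}}·B`, `Δ = B5Prop11Lower.Lap n M`, `Δ_1⁻¹ = (DeltaA n M 1)⁻¹`.
(Location of the printed text: [B5] `Balaban1984PropagatorsI` Prop. 1.2 (1.110) p. 35, fourth entry; the typed inequality — unit cubes,
cubic tori, `a = 1`, NE3's constants — is ours, not a quotation.) [folklore] -/
theorem entry110Lap_one_cubic :
    ∃ δ₀ C : ℝ, 0 < δ₀ ∧ 0 < C ∧
      ∀ (n N₀ : ℕ) [NeZero n] [NeZero N₀], 1 ≤ n →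
        ∀ (y y' : Fin (d + 1) → ℤ) (J : Tor (fine n (fun _ : Fin (d + 1) => N₀)) × Fin (d + 1) → ℂ) (B : ℝ),
          (∀ j, ‖J j‖ ≤ B) →
          (∀ j, J j ≠ 0 → ∃ r' : Fin (d + 1) → Fin n,
              j.1 = bpt n (fun _ : Fin (d + 1) => N₀) (toT (fun _ : Fin (d + 1) => N₀) y') r') →
          ∀ (r : Fin (d + 1) → Fin n) (μ : Fin (d + 1)),
            ‖(Lap n (fun _ : Fin (d + 1) => N₀) *ᵥ
                ((DeltaA n (fun _ : Fin (d + 1) => N₀) 1)⁻¹ *ᵥ J)) (bpt n (fun _ : Fin (d + 1) => N₀) (toT (fun _ : Fin (d + 1) => N₀) y) r, μ)‖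
              ≤ C * Real.exp (-(δ₀ * torusSupNorm (fun _ : Fin (d + 1) => N₀) (y - y'))) * B := by
  obtain ⟨B₄, δ, hB, hδ, hblock⟩ := block_row_sum_Lap_mul_inv_le_cubic (d := d)
  refine ⟨δ, B₄, hδ, hB, ?_⟩
  intro n N₀ _ _ _hn y y' J B hJB hsupp r μ
  rw [Matrix.mulVec_mulVec]
  exact norm_mulVec_bpt_le_of_block_row_sum n (fun _ : Fin (d + 1) => N₀) _ (fun i y₁ => hblock n N₀ i y₁)
    y y' J hJB hsupp r μ

/-- SHAPE CERTIFICATE: the END is the body of the named `Entry110Lap d 1` SPECIALISED to cubic tori — the named Prop (all tori)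
implies it by instantiation `M := fun _ => N₀`, term for term. [folklore] -/
example (h : Entry110Lap d 1) :
    ∃ δ₀ C : ℝ, 0 < δ₀ ∧ 0 < C ∧
      ∀ (n N₀ : ℕ) [NeZero n] [NeZero N₀], 1 ≤ n →
        ∀ (y y' : Fin (d + 1) → ℤ) (J : Tor (fine n (fun _ : Fin (d + 1) => N₀)) × Fin (d + 1) → ℂ) (B : ℝ),
          (∀ j, ‖J j‖ ≤ B) →
          (∀ j, J j ≠ 0 → ∃ r' : Fin (d + 1) → Fin n,
              j.1 = bpt n (fun _ : Fin (d + 1) => N₀) (toT (fun _ : Fin (d + 1) => N₀) y') r') →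
          ∀ (r : Fin (d + 1) → Fin n) (μ : Fin (d + 1)),
            ‖(Lap n (fun _ : Fin (d + 1) => N₀) *ᵥ
                ((DeltaA n (fun _ : Fin (d + 1) => N₀) 1)⁻¹ *ᵥ J)) (bpt n (fun _ : Fin (d + 1) => N₀) (toT (fun _ : Fin (d + 1) => N₀) y) r, μ)‖
              ≤ C * Real.exp (-(δ₀ * torusSupNorm (fun _ : Fin (d + 1) => N₀) (y - y'))) * B := by
  obtain ⟨δ₀, C, hδ₀, hC, h⟩ := h
  exact ⟨δ₀, C, hδ₀, hC, fun n N₀ _ _ hn => h n (fun _ => N₀) hn⟩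

end Summit.QuantumFields.BalabanUV.Beta.GAN24.Entry110LapCubic

end
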